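import Mathlib
import Summits.NavierStokesRegularity.NavierStokesRegularity.Theorems.EulerZoomLiouvillePowerGaugeEulerLiouvilleCasimirHaulSlicing
import HarnessLib

/-!
# Crux `EulerZoomLiouville.PowerGaugeEulerLiouville` (stmt-NavierStokesRegularity-19832), sub-line `casimir_haul` (H3 `stub_haulingInequality`):
# SLICING `ℝ³` ALONG THE AXIS, II — the slice map as a measurable EQUIVALENCE, Bochner Fubini, slice sets

Route №10 `EuclideanSpace` plumbing, sequel of `…CasimirHaulSlicing`: the explicit slice map `(y, t) ↦ toLp 2 ![y 0, y 1, t]` is packaged as a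
measurable equivalence `ℝ² × ℝ ≃ᵐ ℝ³` (inverse `x ↦ (toLp 2 ![x 0, x 1], x 2)`), whence

* `integral_eq_integral_slices` — **Bochner Fubini along the axis**: `∫ x, G x = ∫ t, ∫ y, G (y₀, y₁, t)` for INTEGRABLE `G : ℝ³ → E`;
* `integrable_comp_sliceMap_iff` — `G ∘ slice` is integrable on `ℝ² × ℝ` iff `G` is integrable on `ℝ³`;
* `measurableSet_sliceSet`, `measurable_volume_sliceSet` — the slice sets `A_t = {y | (y₀,y₁,t) ∈ A}` of a measurable `A ⊆ ℝ³` are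
  measurable and `t ↦ |A_t|` is measurable;
* `sliceSet_subset_ball_of_subset` — if `cylRadius < R` on `A` then `A_t ⊆ B(0, R)`.
[folklore]

WHAT THIS IS NOT: not NS, not E, not H3 — plumbing `--supports` stmt-19832; 19832 is OPEN.
-/

noncomputable section

-- flat `Theorems/<Route><Decl>…` files of one crux share the namespace of the crux (tree convention)
set_option linter.dupNamespace false

open MeasureTheory Set Filter Function WithLp Metric
open scoped ENNReal Topology

namespace Summit.NavierStokesRegularity.NavierStokesRegularity.Theorems.PowerGaugeEulerLiouville.CasimirHaul

open Literature.Analysis.FluidPDE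

section Equiv

/-- The slice map is a measurable EQUIVALENCE `ℝ² × ℝ ≃ᵐ ℝ³` (inverse `x ↦ ((x₀, x₁), x₂)`): existence form, so that no new definition
is introduced. [folklore] -/
theorem exists_sliceEquiv :
    ∃ Ψ : EuclideanSpace ℝ (Fin 2) × ℝ ≃ᵐ EuclideanSpace ℝ (Fin 3),
      (∀ p, Ψ p = toLp 2 ![p.1 0, p.1 1, p.2]) ∧ MeasurePreserving Ψ (volume.prod volume) volume := by
  let e : EuclideanSpace ℝ (Fin 2) × ℝ ≃ EuclideanSpace ℝ (Fin 3) :=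
    { toFun := fun p => toLp 2 ![p.1 0, p.1 1, p.2]
      invFun := fun x => (toLp 2 ![x 0, x 1], x 2)
      left_inv := fun p => by
        obtain ⟨y, t⟩ := p
        refine Prod.ext ?_ (by simp)
        ext i; fin_cases i <;> simp
      right_inv := fun x => by
        ext i; fin_cases i <;> simp }
  have hme : Measurable e := measurable_sliceMap
  have hmi : Measurable e.symm := by
    have hc : Continuous fun x : EuclideanSpace ℝ (Fin 3) => ((toLp 2 ![x 0, x 1] : EuclideanSpace ℝ (Fin 2)), x 2) := by
      fun_prop
    exact hc.measurable
  refine ⟨⟨e, hme, hmi⟩, fun p => rfl, ?_⟩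
  exact measurePreserving_sliceMap

/-- **BOCHNER FUBINI ALONG THE AXIS**: `∫ x, G x = ∫ t, ∫ y, G (y₀, y₁, t)` for integrable `G : ℝ³ → E`. [folklore] -/
theorem integral_eq_integral_slices {E : Type*} [NormedAddCommGroup E] [NormedSpace ℝ E]
    {G : EuclideanSpace ℝ (Fin 3) → E} (hG : Integrable G volume) :
    ∫ x, G x = ∫ t : ℝ, ∫ y : EuclideanSpace ℝ (Fin 2), G (toLp 2 ![y 0, y 1, t]) := by
  obtain ⟨Ψ, hΨ, hmp⟩ := exists_sliceEquiv
  have h1 : ∫ x, G x = ∫ p, G (Ψ p) ∂((volume : Measure (EuclideanSpace ℝ (Fin 2))).prod (volume : Measure ℝ)) :=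
    (hmp.integral_comp Ψ.measurableEmbedding G).symm
  have hint : Integrable (fun p => G (Ψ p)) ((volume : Measure (EuclideanSpace ℝ (Fin 2))).prod (volume : Measure ℝ)) :=
    (hmp.integrable_comp_emb Ψ.measurableEmbedding).2 hG
  rw [h1, integral_prod_symm _ hint]
  simp only [hΨ]

/-- **Integrability transfers along the slice map.** [folklore] -/
theorem integrable_comp_sliceMap_iff {E : Type*} [NormedAddCommGroup E] {G : EuclideanSpace ℝ (Fin 3) → E} :
    Integrable (fun p : EuclideanSpace ℝ (Fin 2) × ℝ => G (toLp 2 ![p.1 0, p.1 1, p.2]))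
        ((volume : Measure (EuclideanSpace ℝ (Fin 2))).prod (volume : Measure ℝ)) ↔ Integrable G volume := by
  obtain ⟨Ψ, hΨ, hmp⟩ := exists_sliceEquiv
  have h := hmp.integrable_comp_emb Ψ.measurableEmbedding (g := G)
  have e : (G ∘ Ψ) = fun p : EuclideanSpace ℝ (Fin 2) × ℝ => G (toLp 2 ![p.1 0, p.1 1, p.2]) := funext fun p => by
    rw [Function.comp_apply, hΨ]
  rw [e] at h
  exact h

end Equiv

section SliceSets

/-- Slice sets of a measurable set are measurable. [folklore] -/
theorem measurableSet_sliceSet {A : Set (EuclideanSpace ℝ (Fin 3))} (hA : MeasurableSet A) (t : ℝ) :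
    MeasurableSet {y : EuclideanSpace ℝ (Fin 2) | (toLp 2 ![y 0, y 1, t] : EuclideanSpace ℝ (Fin 3)) ∈ A} := by
  have hc : Continuous fun y : EuclideanSpace ℝ (Fin 2) => (toLp 2 ![y 0, y 1, t] : EuclideanSpace ℝ (Fin 3)) := by fun_prop
  exact hc.measurable hA

/-- **`t ↦ |A_t|` is measurable** (sections of the measurable set `slice⁻¹(A) ⊆ ℝ² × ℝ`). [folklore] -/
theorem measurable_volume_sliceSet {A : Set (EuclideanSpace ℝ (Fin 3))} (hA : MeasurableSet A) :
    Measurable fun t : ℝ => volume {y : EuclideanSpace ℝ (Fin 2) | (toLp 2 ![y 0, y 1, t] : EuclideanSpace ℝ (Fin 3)) ∈ A} := by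
  have hS : MeasurableSet ((fun p : EuclideanSpace ℝ (Fin 2) × ℝ => (toLp 2 ![p.1 0, p.1 1, p.2] : EuclideanSpace ℝ (Fin 3))) ⁻¹' A) :=
    measurable_sliceMap hA
  exact measurable_measure_prodMk_right hS

/-- **Slice sets lie in the disc**: if `cylRadius < R` on `A` then `A_t ⊆ B(0, R)`. [folklore] -/
theorem sliceSet_subset_ball {A : Set (EuclideanSpace ℝ (Fin 3))} {R : ℝ} (hA : ∀ x ∈ A, cylRadius x < R) (t : ℝ) :
    {y : EuclideanSpace ℝ (Fin 2) | (toLp 2 ![y 0, y 1, t] : EuclideanSpace ℝ (Fin 3)) ∈ A} ⊆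
      ball (0 : EuclideanSpace ℝ (Fin 2)) R := by
  intro y hy
  rw [mem_ball_zero_iff, ← cylRadius_sliceMap y t]
  exact hA _ hy

/-- On the SOLID CYLINDER `{r < 2b, |x₂| < b}`: slices are in `B(0, 2b)` and EMPTY for `|t| ≥ b`. [folklore] -/
theorem sliceSet_eq_empty_of_le {A : Set (EuclideanSpace ℝ (Fin 3))} {b : ℝ} (hA : ∀ x ∈ A, |x 2| < b) {t : ℝ} (ht : b ≤ |t|) :
    {y : EuclideanSpace ℝ (Fin 2) | (toLp 2 ![y 0, y 1, t] : EuclideanSpace ℝ (Fin 3)) ∈ A} = ∅ := by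
  ext y
  simp only [mem_setOf_eq, mem_empty_iff_false, iff_false]
  intro hy
  have h := hA _ hy
  simp at h
  linarith

end SliceSets

end Summit.NavierStokesRegularity.NavierStokesRegularity.Theorems.PowerGaugeEulerLiouville.CasimirHaul

end
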